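import Summits.BirchSwinnertonDyer.BirchSwinnertonDyer.Theorems.EisensteinPrimesAlgebraicLambdaGEBudget
import HarnessLib

/-!
# The λ-conjunct `AlgebraicLambdaGE W₀ p k` of `stub_lambdaCount_offLocus` from the kernel's Tamagawa
# budgets — X1 twin (GOOD ORDINARY Eisenstein prime; crux 5 `MazurMCOnX1RankZero`'s currency)
# (route `EisensteinPrimes`, line `mudescent`; seat bsd-eis-lam-b g2, PART 1b seat (5), ALGEBRAIC side)

HONEST FRAMING (cell `bsd-eis`, programme §HONESTY: no tranche here proves BSD; this file moves
nothing between columns by itself): THEOREMS ONLY — no definition, no named fact, nothing asserted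
about any particular curve, closes nothing. Companion of
`Theorems/EisensteinPrimesAlgebraicLambdaGEBudget.lean` (§1 class-agnostic glue, §2 the multiplicative
dischargers); this file is its §3: the same dischargers at a GOOD ORDINARY Eisenstein prime, i.e. in
the currency of the crux-5 skeleton (`X1.MuPart.AnalyticMuLE`, Wuthrich 2014 Thm. 16 in the form
`Wuthrich2014.charIdeal_dvd_padicLFunction`). At good ordinary `p` the b2b cell (eisenstein-p1,
`X1/GeneratorCount*`) already discharges the count to `λ` in the MEMBERSHIP currency
`AlgebraicLambdaMem W p {d | B ≤ d}` at the normalised generator; what is added here is the delivery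
as `X1.TamagawaSqueeze.AlgebraicLambdaGE W p k` (all `κ`, all `γ` — the stub's currency), the
`μ_an ≤ m` reading (`λ ≥ B − m`, Greenberg's inequality) and the end-to-end layer-`0` producer.

* `X1.isTorsion_and_mu_le_of_analyticMuLE` — `X1.MuPart.AnalyticMuLE W p m` + Wuthrich Thm. 16 +
  modularity ⇒ `X` torsion and `μ(X) ≤ m` (Kato's direction; `m = 0` is eisenstein-p1's
  `X1.MuPart.mu_eq_zero_of_analyticMuLE_zero`).
* `X1.algebraicLambdaGE_of_budgetLeLambdaAt_of_analyticMuLE_zero`, `…_of_generatorCountGE_of_analyticMuLE`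
  (`B − m`), `…_of_algebraicLambdaMem_Ici_goodOrd`, and END-TO-END
  `X1.algebraicLambdaGE_of_dvd_localTamagawaNumber` (`p ∤ #E(ℚ)_tors`, `S = {v ∤ p : p ∣ c_v}`,
  `μ_an ≤ m` ⇒ `AlgebraicLambdaGE W p (#S − m)`).

Named PUBLISHED facts as hypotheses exactly as in the composed files: Poitou–Tate duality over `ℚ`
(`hPT`), Greenberg 1999 Prop. 4.15 (ii) (`h415`), Wuthrich 2014 Thm. 16 (`hW16`), modularity (`hmod`).

References: [GreenbergLNM1716] §3 p. 88, Prop. 4.15, §5 pp. 114–118 (proof of Cor. 5.6), p. 137;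
[Washington1997] §13.2; [Wuthrich2014] Thm. 16; [GreenbergVatsal2000] p. 2 (1)–(2);
HOME/b2b-bsdres-eisenstein-p1/X1R0-GAPMAP.md §14.1; HOME/lam-b-MEMO-1.md.
-/

set_option autoImplicit false
-- `Summit.BirchSwinnertonDyer.BirchSwinnertonDyer.…`: the summit and its single sub-problem share a name (D-0017 layout).
set_option linter.dupNamespace false

noncomputable section

open scoped Classical MatrixGroups ModularForm

open PowerSeries CongruenceSubgroup WeierstrassCurve NumberField IsDedekindDomain
  Literature.NumberTheory.EllipticCurves Literature.NumberTheory.GaloisRepresentations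
  Literature.NumberTheory.EllipticCurves.ModularForms
  Literature.NumberTheory.EllipticCurves.Rank1Residual
  Literature.NumberTheory.EllipticCurves.Wuthrich2014
  Literature.NumberTheory.EllipticCurves.Greenberg1999
  Literature.NumberTheory.GaloisCohomology
  Summit.BirchSwinnertonDyer.Rank1Residual
  Summit.BirchSwinnertonDyer.Rank1Residual.X1.MuLambda
  Summit.BirchSwinnertonDyer.Rank1Residual.X1.TamagawaSqueeze
  Summit.BirchSwinnertonDyer.Rank1Residual.X1.GeneratorSqueeze
  Summit.BirchSwinnertonDyer.Rank1Residual.X1.GeneratorCountSqueeze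
  Summit.BirchSwinnertonDyer.Rank1Residual.Additive
  Summit.BirchSwinnertonDyer.BirchSwinnertonDyer.Theorems.EisensteinPrimesAlgebraicLambdaGEBudget

namespace Summit.BirchSwinnertonDyer.BirchSwinnertonDyer.Theorems.EisensteinPrimesX1AlgebraicLambdaGEBudget

variable {W : WeierstrassCurve ℚ} [W.IsElliptic] [W.IsGloballyMinimal] {p : ℕ} [hp : Fact p.Prime]


/-! ## §1. X1: a GOOD ORDINARY Eisenstein prime (`p` odd, `E[p]` reducible) — crux 5's currency -/

section X1

/-- **`X(E/ℚ_∞)` is torsion and `μ(X) ≤ m` at a member with `μ_an ≤ m`** (good ordinary Eisenstein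
pair, `p ≠ 2`): Wuthrich Thm. 16 (`hW16`) + modularity (`hmod`) + the certificate
`X1.MuPart.AnalyticMuLE W p m`: `μ(X) = μ(g) ≤ μ(g·h) ≤ m`. The case `m = 0` is eisenstein-p1's
`X1.MuPart.mu_eq_zero_of_analyticMuLE_zero`. [cite: Wuthrich2014, Thm. 16 (p. 397)] [cite: GreenbergVatsal2000, p. 2, (2)] -/
theorem X1.isTorsion_and_mu_le_of_analyticMuLE (hW16 : Wuthrich2014.charIdeal_dvd_padicLFunction)
    (hmod : nonempty_modularParametrizationData) (hp2 : p ≠ 2)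
    (hgood : W.HasGoodReductionAtPrime p) (hord : ¬ (p : ℤ) ∣ W.frobeniusTrace p)
    (hred : ¬ W.HasIrreducibleModPGaloisRep p) {m : ℕ} (han : X1.MuPart.AnalyticMuLE W p m)
    {κ : ZpExtension ℚ p} {γ : Field.absoluteGaloisGroup ℚ}
    (hκ : κ.IsCyclotomic) (hγ : κ.IsTopGenerator γ) (hγ' : IsCyclotomicVariable p γ)
    (D : W.SelmerDualData κ γ) : D.IsTorsion ∧ D.mu ≤ m := by
  haveI : NeZero (W.conductorNorm ℤ) := ⟨(W.conductorNorm_pos_holds).ne'⟩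
  haveI : Module.Finite (IwasawaAlgebra p) D.X := D.module_finite_holds hγ
  obtain ⟨hD, f, ϖ, g, h, hf, hϖ, hchar, hι⟩ :=
    X1.MuPart.isTorsion_and_exists_factorisation hW16 hmod hp2 hgood hord hred hκ hγ hγ' D
  have hgh : g * h ≠ 0 := mul_ne_zero_of_iota_eq hgood hord hf hϖ D hι
  have hg0 : g ≠ 0 := fun h0 => hgh (by rw [h0, zero_mul])
  have hh : h ≠ 0 := fun h0 => hgh (by rw [h0, mul_zero])
  obtain ⟨n, hn⟩ := han f hf ϖ hϖ
  rw [← hι] at hn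
  refine ⟨hD, ?_⟩
  rw [SelmerDualData.mu, ← X1.MuPart.mu_generator_eq_muInvariant D.X hD hg0 hchar]
  exact (mu_le_mu_mul hg0 hh).trans (X1.MuPart.mu_le_of_lt_norm_coeff hn)

/-- **X1: `BudgetLeLambdaAt p W b ⇒ AlgebraicLambdaGE W p b` at a `μ_an = 0` member.**
[cite: GreenbergLNM1716, §5 pp. 114–118, p. 137] [cite: Wuthrich2014, Thm. 16 (p. 397)] -/
theorem X1.algebraicLambdaGE_of_budgetLeLambdaAt_of_analyticMuLE_zero
    (hW16 : Wuthrich2014.charIdeal_dvd_padicLFunction)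
    (hmod : nonempty_modularParametrizationData) (hp2 : p ≠ 2)
    (hgood : W.HasGoodReductionAtPrime p) (hord : ¬ (p : ℤ) ∣ W.frobeniusTrace p)
    (hred : ¬ W.HasIrreducibleModPGaloisRep p) (hμ0 : X1.MuPart.AnalyticMuLE W p 0) {b : ℕ}
    (hb : BudgetLeLambdaAt p W b) : AlgebraicLambdaGE W p b :=
  algebraicLambdaGE_of_budgetLeLambdaAt
    (fun _ _ hκ hγ hγ' D _ ↦ by
      obtain ⟨hX, hμ⟩ := X1.isTorsion_and_mu_le_of_analyticMuLE hW16 hmod hp2 hgood hord hred hμ0 hκ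
        hγ hγ' D
      exact ⟨hX, Nat.le_zero.mp hμ⟩) hb

/-- **X1: `GeneratorCountGE W p B` at a member with `μ_an ≤ m` ⇒ `AlgebraicLambdaGE W p (B − m)`**
(Greenberg's inequality; Prop. 4.15 (ii) at a good ordinary `p ≥ 3` BY NAME; Wuthrich Thm. 16). The
`m = 0`, membership-currency form is eisenstein-p1's `AlgebraicLambdaMem.of_generatorCount_of_muZero`.
[cite: GreenbergLNM1716, p. 137 and Prop. 4.15 (ii)] [cite: Wuthrich2014, Thm. 16 (p. 397)] -/
theorem X1.algebraicLambdaGE_of_generatorCountGE_of_analyticMuLE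
    (hW16 : Wuthrich2014.charIdeal_dvd_padicLFunction)
    (hmod : nonempty_modularParametrizationData)
    (h415 : prop415ii_noFiniteSubmodule_of_ordinary_or_multiplicative) (hp2 : p ≠ 2)
    (hgood : W.HasGoodReductionAtPrime p) (hord : ¬ (p : ℤ) ∣ W.frobeniusTrace p)
    (hred : ¬ W.HasIrreducibleModPGaloisRep p) {m B : ℕ} (han : X1.MuPart.AnalyticMuLE W p m)
    (hB : GeneratorCountGE W p B) : AlgebraicLambdaGE W p (B - m) :=
  have hp3 : 3 ≤ p := by
    have h2 := hp.out.two_le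
    omega
  algebraicLambdaGE_sub_of_generatorCountGE_of_mu_le
    (fun _ _ hκ hγ hγ' D _ ↦ X1.isTorsion_and_mu_le_of_analyticMuLE hW16 hmod hp2 hgood hord hred han
      hκ hγ hγ' D)
    (X1.GeneratorCountSqueezeFacts.noFiniteSubmoduleAt_of_prop415ii h415 hp3 hgood hord) hB

/-- **X1: route M's membership `AlgebraicLambdaMem W p [k, ∞)` ⇒ `AlgebraicLambdaGE W p k`** (torsion
at the normalised data by Wuthrich Thm. 16 + modularity). [cite: Wuthrich2014, Thm. 16 (p. 397)] -/
theorem X1.algebraicLambdaGE_of_algebraicLambdaMem_Ici_goodOrd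
    (hW16 : Wuthrich2014.charIdeal_dvd_padicLFunction) (hmod : nonempty_modularParametrizationData)
    (hp2 : p ≠ 2) (hgood : W.HasGoodReductionAtPrime p) (hord : ¬ (p : ℤ) ∣ W.frobeniusTrace p)
    (hred : ¬ W.HasIrreducibleModPGaloisRep p) {k : ℕ} (h : AlgebraicLambdaMem W p (Set.Ici k)) :
    AlgebraicLambdaGE W p k :=
  algebraicLambdaGE_of_algebraicLambdaMem_Ici
    (fun _ _ hκ hγ hγ' D _ ↦ by
      haveI : NeZero (W.conductorNorm ℤ) := ⟨(W.conductorNorm_pos_holds).ne'⟩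
      exact (X1.MuPart.isTorsion_and_exists_factorisation hW16 hmod hp2 hgood hord hred hκ hγ hγ'
        D).1) h

/-- **X1, END-TO-END at layer `0`:** `p` odd good ordinary, `E[p]` reducible, `p ∤ #E(ℚ)_tors`, `S`
places `v ∤ p` with `p ∣ c_v(E)`, `μ_an ≤ m` ⇒ `AlgebraicLambdaGE W p (#S − m)`. Named facts `hPT`,
`h415`, `hW16`, `hmod`. [cite: GreenbergLNM1716, §3 p. 88, §5 pp. 114–118, p. 137] [cite: Wuthrich2014, Thm. 16 (p. 397)] -/
theorem X1.algebraicLambdaGE_of_dvd_localTamagawaNumber (hp2 : p ≠ 2)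
    (hPT : poitouTate_selmerStructure_duality ℚ)
    (h415 : prop415ii_noFiniteSubmodule_of_ordinary_or_multiplicative)
    (hW16 : Wuthrich2014.charIdeal_dvd_padicLFunction) (hmod : nonempty_modularParametrizationData)
    (hgood : W.HasGoodReductionAtPrime p) (hord : ¬ (p : ℤ) ∣ W.frobeniusTrace p)
    (hred : ¬ W.HasIrreducibleModPGaloisRep p) (htors : ¬ p ∣ W.torsionOrder)
    (S : Finset (HeightOneSpectrum (𝓞 ℚ))) (hSp : ∀ v ∈ S, ((p : ℕ) : 𝓞 ℚ) ∉ v.asIdeal)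
    (hcv : ∀ v ∈ S,
      p ∣ (W.baseChange (v.adicCompletion ℚ)).localTamagawaNumber (v.adicCompletionIntegers ℚ))
    {m : ℕ} (han : X1.MuPart.AnalyticMuLE W p m) : AlgebraicLambdaGE W p (S.card - m) :=
  X1.algebraicLambdaGE_of_generatorCountGE_of_analyticMuLE hW16 hmod h415 hp2 hgood hord hred han
    (X1.GeneratorCountTamagawa.generatorCountGE_of_dvd_localTamagawaNumber hp2 hPT htors S hSp hcv)

end X1

end Summit.BirchSwinnertonDyer.BirchSwinnertonDyer.Theorems.EisensteinPrimesX1AlgebraicLambdaGEBudget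

end
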